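import Literature.MathematicalPhysics.QuantumFieldTheory.Balaban1983to89.Beta.Envelope
import Summits.QuantumFields.BalabanUV.T4Continuum.Support.NE7EJBracket

/-!
# NE7EJBracketForms — row NE7 (node U5), candidate route HOM, variant H1L-EJ: THE JUNCTION BRACKET FOR QUADRATIC ACTIONS WITH ONE
# CONSTRAINT MAP — EXACT (E2) WITH THE REMAINDER `R₂ = ⟨E H₀B, G₁ E H₀B⟩` AND THE LÖWNER SANDWICH `H₁ᵀEH₁ ⪯ P₁⁻¹ − P₀⁻¹ ⪯ H₀ᵀEH₀`

Lineage `b2b-balaban-t4-ne7-p2` (CRUX PROVER NE7 #2 = C-HOM°'s kernel hand), generation 80; file 108 (after 106 `NE7EJBracket`, 107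
`NE7EJBracketIntegral`).  The LINEARISED case of lens 1's EJ-1b′ (`t4/ideate/NE7/lens1-g58/DEFECT-NOTE.md` §4, toy P-EJ-1′: «the two minimisers
U^A, U^B as linear maps of V, F^A = 𝔇∘U^A, F^B = 𝔇∘U^B, D = t′ − t, R₂ = F^A − D ⪰ 0, R₂′ = D − F^B ⪰ 0 … FINDINGS: (T1) F^B ⪯ D ⪯ F^A …
(T2) R₂ ≥ 0 is small RELATIVE to Br») and of lens 2's S-91-1 (`t4/ideate/NE7/lens2-g91/ENVELOPE-SUPPLY.md` §3 (i): «R₂ is EXACTLY second order in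
the tangential first variation of the defect … the H^{−1}-size of P d𝔇 at the path, squared»), on the objects of an1's
`Literature/…/Balaban1983to89/Beta/Envelope` BY NAME — the finite-dimensional MODEL of [B9] (3.109)–(3.111) ∕ (3.126) ∕ (3.129): a positive
form `K` (rôle of `Δ_a`), a constraint map `Q` with independent rows (the averages), the minimiser map `H = minMap K Q = K⁻¹Qᵀ(QK⁻¹Qᵀ)⁻¹`,
the value form `P⁻¹ = (blockProp K Q)⁻¹ = Hᵀ K H`, the constrained propagator `G = constrProp K Q`.

WHAT IS PROVED ([folklore] finite-dimensional linear algebra over `ℝ`; two positive forms `K₀`, `K₁` («run A», «run B»), `E := K₁ − K₀` of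
ANY sign, one constraint map `Q`):
* §1 `qf K A = ⟨A, K A⟩`, `fibre Q B = {A ∣ Q A = B}`; `qf_sub` ∕ `defect_qf` (the defect of two quadratic actions is the quadratic action of
  `E`); §2 the positivity package: `transpose_eq_of_posDef`, `isUnit_det_of_posDef`, **`blockProp_posDef`** (`Q K⁻¹ Qᵀ ≻ 0` for `K ≻ 0` and `Q`
  with independent rows), `isUnit_blockProp_det` — so an1's standing hypotheses `IsUnit K.det`, `IsUnit (blockProp K Q).det` are DISCHARGED
  from `K.PosDef ∧ Injective Q.vecMul`.
* §3 minimality on the fibre, an1 BY NAME: `minMap_mulVec_mem_fibre`, **`isMinOn_qf_minMap`** (`quad_minMap_le`) — so files 106 ∕ 107 apply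
  verbatim to `(A_c, A_B, S) = (qf K₀, qf K₁, fibre Q B)`; `qf_minMap` (the value `⟨B, P⁻¹B⟩`), `qf_eq_qf_minMap_add` (Pythagoras).
* §4 **(E2) EXACT**: `remB_forms` — `R₂(B) = ⟨H₀B − H₁B, K₁(H₀B − H₁B)⟩` (NO first-order term: criticality of `H₁B`), `remA_forms` likewise;
  `minMap_sub_minMap_mulVec` — `H₀B − H₁B = G₁ E H₀ B` (an1's `minMap_sub_minMap`); `constrProp_transpose`, and **`remB_forms_eq_green`** —
  `R₂(B) = ⟨E H₀B, G₁ (E H₀B)⟩` (lens 2's `q` at `(τ, σ) = (0, 1)`: the constrained-propagator size of the first variation of the defect at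
  run A's minimiser); `bracket_forms` (`Br(B) = ⟨B, (P₁⁻¹ − P₀⁻¹)B⟩`), **`bracket_forms_eq_sub_green`** (`= ⟨H₀B, E H₀B⟩ − ⟨EH₀B, G₁ EH₀B⟩`),
  `bracket_forms_eq_add` (`= ⟨H₁B, E H₁B⟩ + ⟨H₀B − H₁B, K₀(H₀B − H₁B)⟩`).
* §5 POSITIVITY: **`constrProp_posSemidef`** (`G ⪰ 0`, from `G = GᵀKG`), **`inv_sub_constrProp_posSemidef`** (`G ⪯ K⁻¹`: `K⁻¹ − G =
  (QK⁻¹)ᵀP⁻¹(QK⁻¹)`), `green_form_nonneg ∕ green_form_le_inv`; the matrix identities `value_sub_value_second` (`P₁⁻¹ − P₀⁻¹ = H₀ᵀEH₀ −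
  (EH₀)ᵀG₁(EH₀)`) and `value_sub_value_second'` (`= H₁ᵀEH₁ + (EH₁)ᵀG₀(EH₁)`), and **THE LÖWNER SANDWICH** `loewner_upper`
  (`H₀ᵀEH₀ − (P₁⁻¹ − P₀⁻¹) ⪰ 0`), `loewner_lower` (`(P₁⁻¹ − P₀⁻¹) − H₁ᵀEH₁ ⪰ 0`) — lens 1's toy finding (T1) «F^B ⪯ D ⪯ F^A» as a theorem for
  EVERY pair of positive forms and EVERY constraint map with independent rows, `E` of any sign.
* §6 the abstract file instantiated: `forms_sandwich` (`⟨H₁B, EH₁B⟩ ≤ Br(B) ≤ ⟨H₀B, EH₀B⟩` from 106's `defect_le_bracket ∕ bracket_le_defect`).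

HONEST FRAMING: [folklore]; a MODEL statement on an1's dictionary (`K ↔ Δ_a`, `Q ↔` averages, `H ↔` (3.126)), nothing of Bałaban's operators
instantiated; REAL forms only (no complex `V`); the sign of `E` is NOT used (non-abelian F2 = B7 (50) not needed, as lens 1 says); NOT (N1) ∕
(N1′) ∕ EJ-1c ∕ EJ-2 ∕ EJ-3; NOT a letter move (desk: EJ-1a XS, EJ-1b M–L, PRICING-NE7 v43 §315 N-44-2); credit (E2) + (T1)∕(T2) lens 1 g58, the
`H^{−1}`-reading of `R₂` lens 2 g91.  NE7 NOT PRINTED ∕ NOT PROVED; spine 0∕9; FIXED FINITE T⁴, rung (B)+1; NOT infinite volume, NOT mass gap,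
NOT Clay.  HONEST DEPENDENCY: continuum YM on T⁴ ⇐ BetaPertH ∧ nine spine estimates (0/9 proved); BetaPertH ⇐ (D1) ∧ (D4) ∧ CAP+tail; G-an2-4
gates asym, D1 and NE2/3/4.
-/

noncomputable section

open Matrix

namespace Summit.QuantumFields.BalabanUV.T4Continuum.NE7EJBracketForms

open Literature.MathematicalPhysics.QuantumFieldTheory.Balaban1983to89.Beta.Composition (blockProp)
open Literature.MathematicalPhysics.QuantumFieldTheory.Balaban1983to89.Beta.Envelope
open NE7EJBracket

variable {ν μ : Type*} [Fintype ν] [Fintype μ] [DecidableEq ν] [DecidableEq μ]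

/-! ### §1 Quadratic actions, the fibre of prescribed averages, the defect form -/

section Objects

/-- the QUADRATIC ACTION of a form `K`: `qf K A := ⟨A, K A⟩` (twice Bałaban's `½⟨A, Δ_a A⟩` of [B9] (3.111); the `½` is immaterial).
[folklore] -/
def qf (K : Matrix ν ν ℝ) : (ν → ℝ) → ℝ := fun A => A ⬝ᵥ (K *ᵥ A)

/-- the FIBRE of prescribed averages `{A ∣ Q A = B}` ([B9] (3.110)'s hyperplane, finite-dimensional model). [folklore] -/
def fibre (Q : Matrix μ ν ℝ) (B : μ → ℝ) : Set (ν → ℝ) := {A | Q *ᵥ A = B}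

omit [Fintype μ] [DecidableEq ν] [DecidableEq μ] in
/-- unfolding `qf`. [folklore] -/
@[simp] theorem qf_apply (K : Matrix ν ν ℝ) (A : ν → ℝ) : qf K A = A ⬝ᵥ (K *ᵥ A) := rfl

omit [Fintype μ] [DecidableEq ν] [DecidableEq μ] in
/-- unfolding `fibre`. [folklore] -/
@[simp] theorem mem_fibre (Q : Matrix μ ν ℝ) (B : μ → ℝ) (A : ν → ℝ) : A ∈ fibre Q B ↔ Q *ᵥ A = B := Iff.rfl

omit [Fintype μ] [DecidableEq ν] [DecidableEq μ] in
/-- the defect of two quadratic actions is the quadratic action of the difference: `qf K₁ A − qf K₀ A = qf (K₁ − K₀) A`. [folklore] -/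
theorem qf_sub (K₀ K₁ : Matrix ν ν ℝ) (A : ν → ℝ) : qf K₁ A - qf K₀ A = qf (K₁ - K₀) A := by
  simp only [qf_apply, sub_mulVec, dotProduct_sub]

omit [Fintype μ] [DecidableEq ν] [DecidableEq μ] in
/-- `𝔇 = qf E` with `E = K₁ − K₀` (file 106's `defect` for the two quadratic actions). [folklore] -/
theorem defect_qf (K₀ K₁ : Matrix ν ν ℝ) : defect (qf K₀) (qf K₁) = qf (K₁ - K₀) := by
  funext A
  rw [defect_apply, qf_sub]

omit [Fintype μ] [DecidableEq ν] [DecidableEq μ] in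
/-- the quadratic action of a sum ∕ difference of forms is additive in the form. [folklore] -/
theorem qf_add_form (K₀ E : Matrix ν ν ℝ) (A : ν → ℝ) : qf (K₀ + E) A = qf K₀ A + qf E A := by
  simp only [qf_apply, add_mulVec, dotProduct_add]

omit [Fintype μ] [DecidableEq ν] [DecidableEq μ] in
/-- the quadratic action is homogeneous in the form. [folklore] -/
theorem qf_smul_form (c : ℝ) (K : Matrix ν ν ℝ) (A : ν → ℝ) : qf (c • K) A = c * qf K A := by
  rw [qf_apply, qf_apply, smul_mulVec, dotProduct_smul, smul_eq_mul]

omit [Fintype μ] [DecidableEq ν] [DecidableEq μ] in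
/-- symmetric bilinear bookkeeping: for symmetric `K`, `⟨x, K y⟩ = ⟨y, K x⟩` (an1's `dotProduct_mulVec_comm`). [folklore] -/
theorem dot_mulVec_comm {K : Matrix ν ν ℝ} (hKs : Kᵀ = K) (x y : ν → ℝ) : x ⬝ᵥ (K *ᵥ y) = y ⬝ᵥ (K *ᵥ x) :=
  dotProduct_mulVec_comm K hKs x y

omit [DecidableEq ν] [DecidableEq μ] in
/-- `⟨M x, w⟩ = ⟨x, Mᵀ w⟩`. [folklore] -/
theorem mulVec_dotProduct_eq (M : Matrix ν μ ℝ) (x : μ → ℝ) (w : ν → ℝ) : (M *ᵥ x) ⬝ᵥ w = x ⬝ᵥ (Mᵀ *ᵥ w) := by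
  rw [dotProduct_comm, dotProduct_mulVec, ← mulVec_transpose, dotProduct_comm]

end Objects

/-! ### §2 The positivity package over `ℝ`: an1's standing hypotheses from `K ≻ 0` and independent rows of `Q` -/

section Positivity

variable {K : Matrix ν ν ℝ} {Q : Matrix μ ν ℝ}

omit [Fintype ν] [Fintype μ] [DecidableEq ν] [DecidableEq μ] in
/-- a real positive definite matrix is symmetric. [folklore] -/
theorem transpose_eq_of_posDef (hK : K.PosDef) : Kᵀ = K := by
  have h := hK.isHermitian
  rwa [IsHermitian, conjTranspose_eq_transpose_of_trivial] at h

omit [Fintype μ] [DecidableEq μ] in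
/-- a real positive definite matrix has unit determinant class. [folklore] -/
theorem isUnit_det_of_posDef (hK : K.PosDef) : IsUnit K.det :=
  (isUnit_iff_isUnit_det K).mp hK.isUnit

omit [DecidableEq μ] in
/-- **the block propagator `P = Q K⁻¹ Qᵀ` is positive definite** for `K ≻ 0` and `Q` with independent rows (`Injective Q.vecMul`, i.e.
`Qᵀ` injective: the averages are independent constraints). [folklore] -/
theorem blockProp_posDef (hK : K.PosDef) (hQ : Function.Injective Q.vecMul) : (blockProp K Q).PosDef := by
  have h := hK.inv.mul_mul_conjTranspose_same hQ
  rwa [conjTranspose_eq_transpose_of_trivial] at h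

/-- hence `IsUnit (blockProp K Q).det` — an1's second standing hypothesis, discharged. [folklore] -/
theorem isUnit_blockProp_det (hK : K.PosDef) (hQ : Function.Injective Q.vecMul) : IsUnit (blockProp K Q).det :=
  isUnit_det_of_posDef (blockProp_posDef hK hQ)

/-- the value form `P⁻¹` is positive definite. [folklore] -/
theorem blockProp_inv_posDef (hK : K.PosDef) (hQ : Function.Injective Q.vecMul) : (blockProp K Q)⁻¹.PosDef :=
  (blockProp_posDef hK hQ).inv

omit [Fintype μ] [DecidableEq ν] [DecidableEq μ] in
/-- over `ℝ` the quadratic form of a positive semidefinite matrix is non-negative (no `star`). [folklore] -/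
theorem qf_nonneg_of_posSemidef {M : Matrix ν ν ℝ} (hM : M.PosSemidef) (x : ν → ℝ) : 0 ≤ x ⬝ᵥ (M *ᵥ x) := by
  have h := hM.dotProduct_mulVec_nonneg x
  rwa [star_trivial] at h

omit [Fintype μ] [DecidableEq ν] [DecidableEq μ] in
/-- over `ℝ`, symmetric + non-negative quadratic form ⇒ positive semidefinite. [folklore] -/
theorem posSemidef_of_qf_nonneg {M : Matrix ν ν ℝ} (hMs : Mᵀ = M) (h : ∀ x, 0 ≤ x ⬝ᵥ (M *ᵥ x)) : M.PosSemidef := by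
  refine PosSemidef.of_dotProduct_mulVec_nonneg ?_ fun x => ?_
  · rw [IsHermitian, conjTranspose_eq_transpose_of_trivial, hMs]
  · rw [star_trivial]; exact h x

end Positivity

/-! ### §3 Minimality on the fibre (an1 BY NAME): files 106 ∕ 107 apply to `(qf K₀, qf K₁, fibre Q B)` -/

section Minimality

variable {K : Matrix ν ν ℝ} {Q : Matrix μ ν ℝ}

/-- the minimiser `H B` lies on the fibre: `Q (H B) = B` (an1's `constraint_mul_minMap`). [folklore] -/
theorem minMap_mulVec_mem_fibre (hK : K.PosDef) (hQ : Function.Injective Q.vecMul) (B : μ → ℝ) :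
    minMap K Q *ᵥ B ∈ fibre Q B := by
  show Q *ᵥ (minMap K Q *ᵥ B) = B
  rw [mulVec_mulVec, constraint_mul_minMap K Q (isUnit_blockProp_det hK hQ), one_mulVec]

/-- **`H B` MINIMISES the quadratic action on the fibre** (an1's `quad_minMap_le` = [B9] p. 417 «unique minimum», finite-dimensional
skeleton) — the `IsMinOn` hypothesis of files 106 ∕ 107. [folklore] -/
theorem isMinOn_qf_minMap (hK : K.PosDef) (hQ : Function.Injective Q.vecMul) (B : μ → ℝ) :
    IsMinOn (qf K) (fibre Q B) (minMap K Q *ᵥ B) := by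
  rw [isMinOn_iff]
  intro A hA
  exact quad_minMap_le K Q (transpose_eq_of_posDef hK) hK.posSemidef (isUnit_det_of_posDef hK) (isUnit_blockProp_det hK hQ) A B hA

/-- PYTHAGORAS on the fibre (an1's `quad_eq_quad_minMap_add`): `qf K A = qf K (H B) + qf K (A − H B)` for `Q A = B` — the excess over the
minimum is EXACTLY the action of the fluctuation, no first-order term. [folklore] -/
theorem qf_eq_qf_minMap_add (hK : K.PosDef) (hQ : Function.Injective Q.vecMul) {A : ν → ℝ} {B : μ → ℝ} (hA : A ∈ fibre Q B) :
    qf K A = qf K (minMap K Q *ᵥ B) + qf K (A - minMap K Q *ᵥ B) :=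
  quad_eq_quad_minMap_add K Q (transpose_eq_of_posDef hK) (isUnit_det_of_posDef hK) (isUnit_blockProp_det hK hQ) A B hA

/-- THE VALUE: `qf K (H B) = ⟨B, P⁻¹ B⟩` (an1's `transpose_minMap_mul_mul_minMap`: `Hᵀ K H = P⁻¹`). [folklore] -/
theorem qf_minMap (hK : K.PosDef) (hQ : Function.Injective Q.vecMul) (B : μ → ℝ) :
    qf K (minMap K Q *ᵥ B) = B ⬝ᵥ ((blockProp K Q)⁻¹ *ᵥ B) := by
  rw [qf_apply, mulVec_dotProduct_eq, mulVec_mulVec, mulVec_mulVec,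
    transpose_minMap_mul_mul_minMap K Q (transpose_eq_of_posDef hK) (isUnit_det_of_posDef hK) (isUnit_blockProp_det hK hQ)]

end Minimality

/-! ### §4 Two positive forms, one constraint map: (E2) EXACT, and the remainder as a constrained-propagator form -/

section TwoForms

variable {K₀ K₁ : Matrix ν ν ℝ} {Q : Matrix μ ν ℝ}

/-- **(E2) EXACT, the remainder at run A's minimiser**: `R₂(B) = qf K₁ (H₀B) − qf K₁ (H₁B) = qf K₁ (H₀B − H₁B)` — second order in
`H₀B − H₁B`, NO first-order term (criticality of `H₁B` for `qf K₁` on the fibre; Pythagoras). [folklore] -/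
theorem remB_forms (hK₀ : K₀.PosDef) (hK₁ : K₁.PosDef) (hQ : Function.Injective Q.vecMul) (B : μ → ℝ) :
    remB (qf K₁) (minMap K₀ Q *ᵥ B) (minMap K₁ Q *ᵥ B) = qf K₁ (minMap K₀ Q *ᵥ B - minMap K₁ Q *ᵥ B) := by
  rw [remB_def, qf_eq_qf_minMap_add hK₁ hQ (minMap_mulVec_mem_fibre hK₀ hQ B)]
  ring

/-- **(E2) EXACT, the remainder at run B's minimiser**: `R₂′(B) = qf K₀ (H₁B) − qf K₀ (H₀B) = qf K₀ (H₁B − H₀B)`. [folklore] -/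
theorem remA_forms (hK₀ : K₀.PosDef) (hK₁ : K₁.PosDef) (hQ : Function.Injective Q.vecMul) (B : μ → ℝ) :
    remA (qf K₀) (minMap K₀ Q *ᵥ B) (minMap K₁ Q *ᵥ B) = qf K₀ (minMap K₁ Q *ᵥ B - minMap K₀ Q *ᵥ B) := by
  rw [remA_def, qf_eq_qf_minMap_add hK₀ hQ (minMap_mulVec_mem_fibre hK₁ hQ B)]
  ring

/-- THE MINIMISER RESPONSE, exact (an1's `minMap_sub_minMap` with the rôles swapped): `H₀B − H₁B = G₁ E H₀ B`, `E = K₁ − K₀`,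
`G₁ = constrProp K₁ Q`. [folklore] -/
theorem minMap_sub_minMap_mulVec (hK₀ : K₀.PosDef) (hK₁ : K₁.PosDef) (hQ : Function.Injective Q.vecMul) (B : μ → ℝ) :
    minMap K₀ Q *ᵥ B - minMap K₁ Q *ᵥ B = (constrProp K₁ Q * (K₁ - K₀) * minMap K₀ Q) *ᵥ B := by
  have h := minMap_sub_minMap K₁ K₀ Q (isUnit_det_of_posDef hK₁) (isUnit_det_of_posDef hK₀) (isUnit_blockProp_det hK₁ hQ)
    (isUnit_blockProp_det hK₀ hQ)
  have h' : minMap K₀ Q - minMap K₁ Q = constrProp K₁ Q * (K₁ - K₀) * minMap K₀ Q := by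
    rw [h, ← neg_sub K₁ K₀]
    simp only [Matrix.mul_neg, Matrix.neg_mul, neg_neg]
  rw [← sub_mulVec, h']

variable {K : Matrix ν ν ℝ}

/-- the constrained propagator of a symmetric form is symmetric. [folklore] -/
theorem constrProp_transpose (hKs : Kᵀ = K) (Q : Matrix μ ν ℝ) : (constrProp K Q)ᵀ = constrProp K Q := by
  simp only [constrProp, minMap, blockProp_eq, transpose_sub, transpose_mul, transpose_transpose, transpose_nonsing_inv, hKs,
    Matrix.mul_assoc]

/-- **THE REMAINDER AS A CONSTRAINED-PROPAGATOR FORM** (lens 2's `q` at `(τ, σ) = (0, 1)`): `R₂(B) = ⟨E H₀B, G₁ (E H₀B)⟩` — the `G₁`-size of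
the first variation `E H₀B` of the defect at run A's minimiser, squared (`G₁ K₁ G₁ = G₁`, an1's `constrProp_mul_mul_constrProp`). [folklore] -/
theorem remB_forms_eq_green (hK₀ : K₀.PosDef) (hK₁ : K₁.PosDef) (hQ : Function.Injective Q.vecMul) (B : μ → ℝ) :
    remB (qf K₁) (minMap K₀ Q *ᵥ B) (minMap K₁ Q *ᵥ B) =
      ((K₁ - K₀) *ᵥ (minMap K₀ Q *ᵥ B)) ⬝ᵥ (constrProp K₁ Q *ᵥ ((K₁ - K₀) *ᵥ (minMap K₀ Q *ᵥ B))) := by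
  rw [remB_forms hK₀ hK₁ hQ, minMap_sub_minMap_mulVec hK₀ hK₁ hQ, qf_apply]
  set x : ν → ℝ := (K₁ - K₀) *ᵥ (minMap K₀ Q *ᵥ B) with hx
  have hGx : (constrProp K₁ Q * (K₁ - K₀) * minMap K₀ Q) *ᵥ B = constrProp K₁ Q *ᵥ x := by
    rw [hx, mulVec_mulVec, mulVec_mulVec, Matrix.mul_assoc]
  rw [hGx, mulVec_dotProduct_eq, constrProp_transpose (transpose_eq_of_posDef hK₁), mulVec_mulVec, mulVec_mulVec,
    constrProp_mul_mul_constrProp K₁ Q (isUnit_det_of_posDef hK₁) (isUnit_blockProp_det hK₁ hQ)]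

/-- THE BRACKET OF THE TWO QUADRATIC ACTIONS is the value-form difference: `Br(B) = ⟨B, (P₁⁻¹ − P₀⁻¹) B⟩`. [folklore] -/
theorem bracket_forms (hK₀ : K₀.PosDef) (hK₁ : K₁.PosDef) (hQ : Function.Injective Q.vecMul) (B : μ → ℝ) :
    bracket (qf K₀) (qf K₁) (minMap K₀ Q *ᵥ B) (minMap K₁ Q *ᵥ B) = B ⬝ᵥ (((blockProp K₁ Q)⁻¹ - (blockProp K₀ Q)⁻¹) *ᵥ B) := by
  rw [bracket_def, qf_minMap hK₀ hQ, qf_minMap hK₁ hQ, sub_mulVec, dotProduct_sub]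

/-- **(E2) FOR FORMS, first form**: `⟨B, (P₁⁻¹ − P₀⁻¹)B⟩ = ⟨H₀B, E H₀B⟩ − ⟨E H₀B, G₁ E H₀B⟩`. [folklore] -/
theorem bracket_forms_eq_sub_green (hK₀ : K₀.PosDef) (hK₁ : K₁.PosDef) (hQ : Function.Injective Q.vecMul) (B : μ → ℝ) :
    B ⬝ᵥ (((blockProp K₁ Q)⁻¹ - (blockProp K₀ Q)⁻¹) *ᵥ B) =
      qf (K₁ - K₀) (minMap K₀ Q *ᵥ B) -
        ((K₁ - K₀) *ᵥ (minMap K₀ Q *ᵥ B)) ⬝ᵥ (constrProp K₁ Q *ᵥ ((K₁ - K₀) *ᵥ (minMap K₀ Q *ᵥ B))) := by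
  rw [← bracket_forms hK₀ hK₁ hQ, bracket_eq_defect_sub_remB, defect_qf, remB_forms_eq_green hK₀ hK₁ hQ]

/-- **(E2) FOR FORMS, second form**: `⟨B, (P₁⁻¹ − P₀⁻¹)B⟩ = ⟨H₁B, E H₁B⟩ + ⟨H₀B − H₁B, K₀ (H₀B − H₁B)⟩`. [folklore] -/
theorem bracket_forms_eq_add (hK₀ : K₀.PosDef) (hK₁ : K₁.PosDef) (hQ : Function.Injective Q.vecMul) (B : μ → ℝ) :
    B ⬝ᵥ (((blockProp K₁ Q)⁻¹ - (blockProp K₀ Q)⁻¹) *ᵥ B) =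
      qf (K₁ - K₀) (minMap K₁ Q *ᵥ B) + qf K₀ (minMap K₁ Q *ᵥ B - minMap K₀ Q *ᵥ B) := by
  rw [← bracket_forms hK₀ hK₁ hQ, bracket_eq_defect_add_remA, defect_qf, remA_forms hK₀ hK₁ hQ]

end TwoForms

/-! ### §5 Positivity: `0 ⪯ G ⪯ K⁻¹`, the second-order identities as matrices, and the LÖWNER SANDWICH -/

section Loewner

variable {K K₀ K₁ : Matrix ν ν ℝ} {Q : Matrix μ ν ℝ}

/-- **`G ⪰ 0`**: the constrained propagator of a positive form is positive semidefinite (`G = Gᵀ K G`). [folklore] -/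
theorem constrProp_posSemidef (hK : K.PosDef) (hQ : Function.Injective Q.vecMul) : (constrProp K Q).PosSemidef := by
  have hid : (constrProp K Q)ᴴ * K * constrProp K Q = constrProp K Q := by
    rw [conjTranspose_eq_transpose_of_trivial, constrProp_transpose (transpose_eq_of_posDef hK),
      constrProp_mul_mul_constrProp K Q (isUnit_det_of_posDef hK) (isUnit_blockProp_det hK hQ)]
  rw [← hid]
  exact hK.posSemidef.conjTranspose_mul_mul_same _

/-- **`G ⪯ K⁻¹`**: `K⁻¹ − G = (Q K⁻¹)ᵀ P⁻¹ (Q K⁻¹) ⪰ 0` — the constrained propagator is dominated by the free one. [folklore] -/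
theorem inv_sub_constrProp_posSemidef (hK : K.PosDef) (hQ : Function.Injective Q.vecMul) : (K⁻¹ - constrProp K Q).PosSemidef := by
  have hKs := transpose_eq_of_posDef hK
  have hid : K⁻¹ - constrProp K Q = (Q * K⁻¹)ᴴ * (blockProp K Q)⁻¹ * (Q * K⁻¹) := by
    rw [conjTranspose_eq_transpose_of_trivial, constrProp, sub_sub_cancel, minMap, transpose_mul, transpose_nonsing_inv, hKs]
    simp only [Matrix.mul_assoc]
  rw [hid]
  exact (blockProp_inv_posDef hK hQ).posSemidef.conjTranspose_mul_mul_same _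

/-- `0 ≤ ⟨x, G x⟩`. [folklore] -/
theorem green_form_nonneg (hK : K.PosDef) (hQ : Function.Injective Q.vecMul) (x : ν → ℝ) : 0 ≤ x ⬝ᵥ (constrProp K Q *ᵥ x) :=
  qf_nonneg_of_posSemidef (constrProp_posSemidef hK hQ) x

/-- `⟨x, G x⟩ ≤ ⟨x, K⁻¹ x⟩`. [folklore] -/
theorem green_form_le_inv (hK : K.PosDef) (hQ : Function.Injective Q.vecMul) (x : ν → ℝ) :
    x ⬝ᵥ (constrProp K Q *ᵥ x) ≤ x ⬝ᵥ (K⁻¹ *ᵥ x) := by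
  have h := qf_nonneg_of_posSemidef (inv_sub_constrProp_posSemidef hK hQ) x
  rw [sub_mulVec, dotProduct_sub] at h
  linarith

/-- **THE SECOND-ORDER IDENTITY AS MATRICES** (an1's `value_sub_value` + `minMap_sub_minMap`, symmetric case):
`P₁⁻¹ − P₀⁻¹ = H₀ᵀ E H₀ − (E H₀)ᵀ G₁ (E H₀)`, `E = K₁ − K₀`. [folklore] -/
theorem value_sub_value_second (hK₀ : K₀.PosDef) (hK₁ : K₁.PosDef) (hQ : Function.Injective Q.vecMul) :
    (blockProp K₁ Q)⁻¹ - (blockProp K₀ Q)⁻¹ =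
      (minMap K₀ Q)ᵀ * (K₁ - K₀) * minMap K₀ Q -
        ((K₁ - K₀) * minMap K₀ Q)ᵀ * constrProp K₁ Q * ((K₁ - K₀) * minMap K₀ Q) := by
  have hu₀ := isUnit_det_of_posDef hK₀
  have hu₁ := isUnit_det_of_posDef hK₁
  have hp₀ := isUnit_blockProp_det hK₀ hQ
  have hp₁ := isUnit_blockProp_det hK₁ hQ
  have hE : (K₁ - K₀)ᵀ = K₁ - K₀ := by rw [transpose_sub, transpose_eq_of_posDef hK₀, transpose_eq_of_posDef hK₁]
  have h1 := value_sub_value K₀ K₁ Q hu₀ hu₁ hp₀ hp₁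
  rw [minMapL_eq_transpose K₀ Q (transpose_eq_of_posDef hK₀)] at h1
  have h2 := minMap_sub_minMap K₁ K₀ Q hu₁ hu₀ hp₁ hp₀
  have h3 : minMap K₁ Q = minMap K₀ Q - constrProp K₁ Q * (K₁ - K₀) * minMap K₀ Q := by
    have : minMap K₁ Q = minMap K₀ Q - (minMap K₀ Q - minMap K₁ Q) := by abel
    rw [this, h2, ← neg_sub K₁ K₀]
    simp only [Matrix.mul_neg, Matrix.neg_mul, neg_neg]
  rw [h1, h3, transpose_mul, hE]
  generalize K₁ - K₀ = E
  rw [Matrix.mul_sub]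
  simp only [Matrix.mul_assoc]

/-- the same identity read from run B's side: `P₁⁻¹ − P₀⁻¹ = H₁ᵀ E H₁ + (E H₁)ᵀ G₀ (E H₁)`. [folklore] -/
theorem value_sub_value_second' (hK₀ : K₀.PosDef) (hK₁ : K₁.PosDef) (hQ : Function.Injective Q.vecMul) :
    (blockProp K₁ Q)⁻¹ - (blockProp K₀ Q)⁻¹ =
      (minMap K₁ Q)ᵀ * (K₁ - K₀) * minMap K₁ Q +
        ((K₁ - K₀) * minMap K₁ Q)ᵀ * constrProp K₀ Q * ((K₁ - K₀) * minMap K₁ Q) := by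
  have h := value_sub_value_second hK₁ hK₀ hQ
  have hneg : K₀ - K₁ = -(K₁ - K₀) := (neg_sub K₁ K₀).symm
  rw [hneg] at h
  simp only [Matrix.neg_mul, Matrix.mul_neg, transpose_neg, neg_neg] at h
  rw [← neg_sub (blockProp K₀ Q)⁻¹ (blockProp K₁ Q)⁻¹, h]
  abel

/-- **LÖWNER SANDWICH, upper half**: `H₀ᵀ E H₀ − (P₁⁻¹ − P₀⁻¹) = (EH₀)ᵀ G₁ (EH₀) ⪰ 0` — the bracket form is dominated by the defect form at
run A's minimiser (lens 1's (T1) «D ⪯ F^A», every pair of positive forms, `E` of any sign). [folklore] -/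
theorem loewner_upper (hK₀ : K₀.PosDef) (hK₁ : K₁.PosDef) (hQ : Function.Injective Q.vecMul) :
    ((minMap K₀ Q)ᵀ * (K₁ - K₀) * minMap K₀ Q - ((blockProp K₁ Q)⁻¹ - (blockProp K₀ Q)⁻¹)).PosSemidef := by
  rw [value_sub_value_second hK₀ hK₁ hQ, sub_sub_cancel, ← conjTranspose_eq_transpose_of_trivial]
  exact (constrProp_posSemidef hK₁ hQ).conjTranspose_mul_mul_same _

/-- **LÖWNER SANDWICH, lower half**: `(P₁⁻¹ − P₀⁻¹) − H₁ᵀ E H₁ = (EH₁)ᵀ G₀ (EH₁) ⪰ 0` — the bracket form dominates the defect form at run B's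
minimiser (lens 1's (T1) «F^B ⪯ D»). [folklore] -/
theorem loewner_lower (hK₀ : K₀.PosDef) (hK₁ : K₁.PosDef) (hQ : Function.Injective Q.vecMul) :
    (((blockProp K₁ Q)⁻¹ - (blockProp K₀ Q)⁻¹) - (minMap K₁ Q)ᵀ * (K₁ - K₀) * minMap K₁ Q).PosSemidef := by
  rw [value_sub_value_second' hK₀ hK₁ hQ, add_sub_cancel_left, ← conjTranspose_eq_transpose_of_trivial]
  exact (constrProp_posSemidef hK₀ hQ).conjTranspose_mul_mul_same _

end Loewner

/-! ### §6 The abstract file instantiated: the sandwich for forms -/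

section Instance

variable {K₀ K₁ : Matrix ν ν ℝ} {Q : Matrix μ ν ℝ}

/-- **the sandwich for forms** from file 106 (`defect_le_bracket ∕ bracket_le_defect` at `(A_c, A_B, S) = (qf K₀, qf K₁, fibre Q B)`):
`⟨H₁B, E H₁B⟩ ≤ ⟨B, (P₁⁻¹ − P₀⁻¹)B⟩ ≤ ⟨H₀B, E H₀B⟩`. [folklore] -/
theorem forms_sandwich (hK₀ : K₀.PosDef) (hK₁ : K₁.PosDef) (hQ : Function.Injective Q.vecMul) (B : μ → ℝ) :
    qf (K₁ - K₀) (minMap K₁ Q *ᵥ B) ≤ B ⬝ᵥ (((blockProp K₁ Q)⁻¹ - (blockProp K₀ Q)⁻¹) *ᵥ B) ∧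
      B ⬝ᵥ (((blockProp K₁ Q)⁻¹ - (blockProp K₀ Q)⁻¹) *ᵥ B) ≤ qf (K₁ - K₀) (minMap K₀ Q *ᵥ B) := by
  rw [← bracket_forms hK₀ hK₁ hQ, ← defect_qf]
  exact ⟨defect_le_bracket (isMinOn_qf_minMap hK₀ hQ B) (minMap_mulVec_mem_fibre hK₁ hQ B),
    bracket_le_defect (isMinOn_qf_minMap hK₁ hQ B) (minMap_mulVec_mem_fibre hK₀ hQ B)⟩

/-- `R₂(B) ≥ 0` and `R₂(B) ≤ ⟨E H₀B, K₁⁻¹ E H₀B⟩`: the remainder is non-negative and at most the FREE-propagator size of the first variation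
(`G₁ ⪯ K₁⁻¹`). [folklore] -/
theorem remB_forms_bounds (hK₀ : K₀.PosDef) (hK₁ : K₁.PosDef) (hQ : Function.Injective Q.vecMul) (B : μ → ℝ) :
    0 ≤ remB (qf K₁) (minMap K₀ Q *ᵥ B) (minMap K₁ Q *ᵥ B) ∧
      remB (qf K₁) (minMap K₀ Q *ᵥ B) (minMap K₁ Q *ᵥ B) ≤
        ((K₁ - K₀) *ᵥ (minMap K₀ Q *ᵥ B)) ⬝ᵥ (K₁⁻¹ *ᵥ ((K₁ - K₀) *ᵥ (minMap K₀ Q *ᵥ B))) := by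
  rw [remB_forms_eq_green hK₀ hK₁ hQ]
  exact ⟨green_form_nonneg hK₁ hQ _, green_form_le_inv hK₁ hQ _⟩

end Instance

end Summit.QuantumFields.BalabanUV.T4Continuum.NE7EJBracketForms

end
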